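import Literature.AlgebraicGeometry.Resolution.RegularLocalOrderValuation
import Mathlib.RingTheory.MvPowerSeries.Basic
import Mathlib.RingTheory.PowerSeries.Inverse
import HarnessLib

/-!
# Hyperplanarity of the codimension-two equimultiple locus of a hypersurface (Mulay 1983)

Topic `Literature/AlgebraicGeometry/Resolution`. A NAMED FACT (statement only, `def … : Prop`; users take it as a hypothesis),
typed from the page: S. B. Mulay, *Equimultiplicity and hyperplanarity*, Proc. Amer. Math. Soc. **89** (1983), no. 3,
407–413 (lit key `paper:url-29aeafb0cf6c`, held; read 2026-08-27).

WHAT THE PAPER PRINTS (verbatim where short).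
* Abstract / §4 MAIN THEOREM (p. 413): «Let `R` be an excellent regular local domain containing a field. Let `F` be a nonzero
  principal ideal in `R`, contained in `m(R)`. Then the 2-codimensional equimultiple locus of `(R, F)` is hyperplanar.»
  COROLLARY (p. 413): «In the above set-up, if `dim R = 3` then `E(R, F)` is hyperplanar.»
* §1.1 (p. 408): `Π(R, F, d) = {P ∈ Spec(R) | F ⊆ P^{(d)}}`, `Πⁱ` its `i`-codimensional part (`dim R_P = i`),
  `E(R, F) = Π(R, F, ord_R F)` the equimultiple locus, `Eⁱ(R, F)` its `i`-codimensional part.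
* §1.3 (p. 408): «A subset `E` of `Spec(R)` is said to be hyperplanar if there exists a regular parameter `z` of `R` such that
  `z ∈ P` for all `P` in `E`. (a) A subset `E` is hyperplanar iff `I(E) ⊄ M(R)²`. (b) If `E` is hyperplanar then every subset of
  `E` is hyperplanar. (c) … If `E¹(R, F) ≠ ∅`, then there exists a regular parameter `z` of `R` such that `z^d R = FR`, where
  `d = ord_R F`; and hence `E(R, F)` is hyperplanar.» A «regular parameter» is an element of `m(R) ∖ m(R)²` (§3.9, p. 412:
  «choose an `x` in `P̄` such that `x ∉ P̄^{(2)}`. Then `x` is a regular parameter of `R̄`»).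

WHAT IS TYPED HERE (a SPECIAL CASE, implied by the printed theorem via §1.3 (b)): `R = K⟦X_{Fin d}⟧` for a field `K` — a
complete, hence excellent, regular local domain containing the field `K` (the reduction to the complete case is the paper's
own §1.4–1.5 / proof of §4); `F = (g)`, `g ≠ 0`, `g ∈ 𝔪`; the SUBFAMILY of `E²(R, (g))` consisting of the primes
`P = (u_i : i ∈ S)` generated by TWO members of a regular system of parameters `u` (these are height-2 primes with regular
quotient, and `g ∈ P^{ord g} ⊆ P^{(ord g)}`); conclusion: ONE element `z ∈ 𝔪 ∖ 𝔪²` lying in all of them. The order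
`ord_R g` is the tree's `adicOrder g` (finite for `g ≠ 0`, `adicOrder_ne_top`).
-- TODO(general form): the paper proves it for every excellent regular local domain containing a field and for ALL height-2
-- primes `P` with `F ⊆ P^{(ord F)}` (symbolic power), including singular curves; neither excellence nor symbolic powers of
-- non-complete-intersection primes are needed by the present consumer, so only the power-series / coordinate-prime slice is
-- stated.

WHY IT IS HERE. Consumer: the `res-hironaka` campaign (run/shared/lean/pub/res-hironaka/), rung L, RESCUE-SEED slot W2.2 — the
uniform-contact («uniform A1») question for purely inseparable surface heads `y^q + ε` in a regular threefold germ
(`Summits/ResolutionOfSingularities/…/Theorems/MarkedTransferCampaignW22UniformContactDim.lean`): Mulay's `z` is the smooth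
surface germ through all permissible curves. Related catalogue entry: `Literature/Barriers/ResolutionOfSingularities/
NarasimhanMaximalContact.lean` (Narasimhan 1983: hyperplanarity FAILS for threefolds in `𝔸⁴`, characteristic 2), which cites
this paper as [cite: Mulay1983] for the positive codimension-2 statement. Nothing here is a statement of H. Hironaka's 2017
manuscript. AI typing; weaker than expert review.

## References
* S. B. Mulay, *Equimultiplicity and hyperplanarity*, Proc. Amer. Math. Soc. 89 (1983) 407–413, §1.1, §1.3, §4 Main Theorem
  and Corollary (p. 413). [Mulay1983]
* R. Narasimhan, *Hyperplanarity of the equimultiple locus*, Proc. Amer. Math. Soc. 87 (1983) 403–408 (the counterexample in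
  dimension 4 that bounds the theorem). [Narasimhan1983]
-/

namespace Literature.AlgebraicGeometry.Resolution

open IsLocalRing

universe u

/-- NAMED FACT — **Mulay 1983, Main Theorem (p. 413) with §1.3**: «Let `R` be an excellent regular local domain containing a
field. Let `F` be a nonzero principal ideal in `R`, contained in `m(R)`. Then the 2-codimensional equimultiple locus of
`(R, F)` is hyperplanar», i.e. (§1.3) «there exists a regular parameter `z` of `R` such that `z ∈ P` for all `P`» in it; by
§1.3 (b) every subfamily is then hyperplanar with the same `z`. SPECIAL CASE typed: `R = K⟦X_{Fin d}⟧` (`K` a field),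
`F = (g)` with `g ≠ 0`, `g ∈ 𝔪`, and the subfamily of height-2 primes `P = (u_i : i ∈ S)`, `#S = 2`, cut out by two members
of a regular system of parameters `u` (`(u_0,…,u_{d−1}) = 𝔪`) with `g ∈ P^{ord g}` (`⊆ P^{(ord g)}`, so `P ∈ E²(R, (g))`;
`ord g = adicOrder g`, finite): ONE `z ∈ 𝔪 ∖ 𝔪²` (a regular parameter) lies in every such `P`. Users take
`(h : Mulay1983_codimTwoHyperplanar)`. Vacuity check: not idle — for `d = 3`, `g = y^q + ε` a purely inseparable surface head,
the family is the set of permissible smooth curves and `z` is a smooth surface through all of them (false in `d = 4` by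
Narasimhan's example, which is excluded because there the relevant primes have height 3 = `d − 1`, not 2);
`d ≤ 1`: the family is empty and `z` exists since `𝔪 ≠ 0`. [cite: Mulay1983, §4 Main Theorem and Corollary p. 413; §1.3 p. 408] -/
def Mulay1983_codimTwoHyperplanar : Prop :=
  ∀ (K : Type u) [Field K] (d : ℕ) (g : MvPowerSeries (Fin d) K),
    g ≠ 0 → g ∈ maximalIdeal (MvPowerSeries (Fin d) K) →
      ∃ z : MvPowerSeries (Fin d) K,
        z ∈ maximalIdeal (MvPowerSeries (Fin d) K) ∧ z ∉ maximalIdeal (MvPowerSeries (Fin d) K) ^ 2 ∧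
          ∀ (u : Fin d → MvPowerSeries (Fin d) K),
            Ideal.span (Set.range u) = maximalIdeal (MvPowerSeries (Fin d) K) →
              ∀ (S : Finset (Fin d)), S.card = 2 →
                g ∈ Ideal.span (u '' (S : Set (Fin d))) ^ (adicOrder g).toNat →
                  z ∈ Ideal.span (u '' (S : Set (Fin d)))

end Literature.AlgebraicGeometry.Resolution
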